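import Literature.Analysis.FluidPDE.StokesLocalEnergyEquality
import Literature.Analysis.FluidPDE.WeakGradientTransportIdentity
import Literature.Analysis.FluidPDE.WeakSpatialGradientSum
import Literature.Analysis.FluidPDE.ClassicalSuitable
import Literature.Analysis.FluidPDE.PeriodicLerayGalerkinSystem
import HarnessLib

/-!
# [BT1] the local energy balance (iv) of the mollified perturbed Leray system from the Stokes form

Analysis/FluidPDE proof file (theorems only; no definitions, no named facts) in the DAG below the
named fact `Literature.Analysis.FluidPDE.bradshawTsai2017_thm_2_4_mollified`
(`PeriodicLerayExistence.lean`; Bradshaw–Tsai, Ann. Henri Poincaré 18 (2017) = arXiv:1510.07504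
[BT1], proof of Thm 2.4: "the approximating solutions `(u_ε, p_ε)` all satisfy the local energy
equality"). Write `u = U + W`, `∇u = G + DW` (`G` a weak spatial gradient of `U`), `b = W + V`
(`V = η_ε * U` in [BT1]). If `(u, p)` solves the forced Stokes system
`∂ₛu − Δu + ∇p = f`, `f = u + (∇u) y − G b − DW u`, in `𝒟'(ℝ × ℝ³)` — the form into which the
`distributional` clause of `IsMollifiedPeriodicWeakSolution` is brought by moving the
lower-order terms back onto the unknown — then the tree's local energy **equality** for
distributional Stokes solutions with `p ∈ L^{5/3}_loc`, `u ∈ L^{5/2}_loc`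
(`IsDistributionalStokesSolutionOn.local_energy_equality_holder`, `StokesLocalEnergyEquality`)
and the transport identities `∫∫⟪(∇u) y, u⟫φ = −½∫∫|u|²(3φ + y·∇φ)`,
`∫∫⟪(∇u) b, u⟫φ = −½∫∫|u|²(b·∇φ)` (`div b = 0`; `WeakGradientTransportIdentity`) give, for every
test function `ψ`,

  `∫∫ (½|u|² + |∇u|²) ψ = ∫∫ ½|u|²(∂ₛψ + Δψ) + ∫∫ (½|u|²((b − y)·∇ψ) + p (u·∇ψ))
      − ∫∫ ⟪DW (U − V), u⟫ ψ`

(`local_energy_balance_eq`, since `⟪f, u⟫ = |u|² + ⟪(∇u)y, u⟫ − ⟪(∇u) b, u⟫ + ⟪DW b, u⟫ − ⟪DW u, u⟫`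
and `u − b = U − V`): clause (iv) of `IsMollifiedPeriodicWeakSolution.weakForm`, with equality
and in iterated-integral form (`local_energy_balance_iterated`).

## Mathlib / tree search

Tree (all used): `IsDistributionalStokesSolutionOn(.local_energy_equality_holder)`
(`SereginLocalStokesRegularity`, `StokesLocalEnergyEquality`);
`HasWeakSpatialGradientOn.integral_inner_apply_self_mul_eq / _drift_mul_eq`
(`WeakGradientTransportIdentity`); `HasWeakSpatialGradientOn.add` (`WeakSpatialGradientSum`);
`hasWeakSpatialGradientOn_of_contDiffOn` (`ClassicalSuitable`);
`memLp_two_restrict_of_locallyIntegrableOn_sq` (`StokesLocalEnergyEquality`).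
Mathlib: `MemLp.integrable_mul`, `integral_prod`, `Integrable.bdd_mul`.

## References

* Z. Bradshaw, T.-P. Tsai, Ann. Henri Poincaré 18 (2017) = arXiv:1510.07504, proof of Thm 2.4
  (local energy equality of the approximants) [BradshawTsai2017AHP].
* L. Caffarelli, R. Kohn, L. Nirenberg, Comm. Pure Appl. Math. 35 (1982), §2 (2.5)
  [CaffarelliKohnNirenberg1982].
-/

noncomputable section

open MeasureTheory Set Function Filter Topology TopologicalSpace Metric Module ContinuousLinearMap
open scoped NNReal ENNReal InnerProductSpace RealInnerProductSpace Laplacian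

namespace Literature.Analysis.FluidPDE

namespace BradshawTsai2017

/-! ### Integrability helpers on `ℝ × ℝ³` -/

section Helpers

variable {X : Type*} [NormedAddCommGroup X]

/-- An integrable function on a compact `K` supported in `K` is integrable on the whole space —
DEPRECATED duplicate of Mathlib's `IntegrableOn.integrable_of_forall_notMem_eq_zero` (librarian dedup
2026-08-16, work item dedup-01231): the statement is literally
`IntegrableOn.integrable_of_forall_notMem_eq_zero hf hf0`; kept under its old name as a one-line alias
proof (never deleted), no longer used in this file. [folklore] -/
@[deprecated IntegrableOn.integrable_of_forall_notMem_eq_zero (since := "2026-08-16")]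
theorem integrable_of_integrableOn_of_support_subset {K : Set (ℝ × EuclideanSpace ℝ (Fin 3))}
    {f : ℝ × EuclideanSpace ℝ (Fin 3) → X} (hf0 : ∀ z, z ∉ K → f z = 0)
    (hf : Integrable f (volume.restrict K)) : Integrable f volume :=
  IntegrableOn.integrable_of_forall_notMem_eq_zero hf hf0

/-- `1/(5/3) + 1/(5/2) = 1`. [folklore] -/
theorem holderTriple_five_thirds_five_halves : ENNReal.HolderTriple (5 / 3 : ℝ≥0∞) (5 / 2) 1 := by
  refine ⟨?_⟩
  rw [ENNReal.inv_div (Or.inr (by norm_num)) (Or.inr (by norm_num)),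
    ENNReal.inv_div (Or.inr (by norm_num)) (Or.inr (by norm_num)), inv_one, ENNReal.div_add_div_same,
    show (3 : ℝ≥0∞) + 2 = 5 by norm_num, ENNReal.div_self (by norm_num) (by norm_num)]

end Helpers

/-! ### The local energy balance -/

section Main

variable {U W V : ℝ → EuclideanSpace ℝ (Fin 3) → EuclideanSpace ℝ (Fin 3)}
  {G : ℝ → EuclideanSpace ℝ (Fin 3) → EuclideanSpace ℝ (Fin 3) →L[ℝ] EuclideanSpace ℝ (Fin 3)}
  {p : ℝ → EuclideanSpace ℝ (Fin 3) → ℝ}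

set_option maxHeartbeats 1600000 in
/-- **The local energy balance of the mollified perturbed Leray system from its Stokes form**
(space–time integrals). Let `W` be a `C¹` profile with divergence-free slices, `V` jointly
measurable, bounded, `C¹` in space with divergence-free slices (a.e.), `G` a weak spatial gradient
of `U` on `ℝ × ℝ³` with `|U|², |G|² ∈ L¹_loc`, `p ∈ L^{5/3}_loc`, `U ∈ L^{5/2}_loc`, and let
`(u, p)`, `u = U + W`, solve in `𝒟'(ℝ × ℝ³)` the forced Stokes system with force
`f = u + (G + DW) y − G (W + V) − DW u`. Then for every test function `ψ`
`∫∫ (½|u|² + |G + DW|²_F) ψ = ∫∫ (½|u|²(∂ₛψ + Δψ) + (½|u|²⟪W + V − y, ∇ψ⟫ + p⟪u, ∇ψ⟫)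
  − ⟪DW (U − V), u⟫ψ)`. [cite: BradshawTsai2017AHP, proof of Thm 2.4 (local energy equality of the approximants); CaffarelliKohnNirenberg1982, §2 (2.5)] -/
theorem local_energy_balance_eq (hW : ContDiff ℝ 1 (uncurry W))
    (hdivW : ∀ s, VectorCalculus.IsDivFree (W s))
    (hV1 : ∀ s, ContDiff ℝ 1 (V s)) (hVm : AEStronglyMeasurable (uncurry V) volume) {CV : ℝ}
    (hVb : ∀ s y, ‖V s y‖ ≤ CV)
    (hdivV : ∀ᵐ z : ℝ × EuclideanSpace ℝ (Fin 3), VectorCalculus.divergence (V z.1) z.2 = 0)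
    (hG : HasWeakSpatialGradientOn (⊤ : Opens (ℝ × EuclideanSpace ℝ (Fin 3))) U G)
    (hU2 : LocallyIntegrable (fun z : ℝ × EuclideanSpace ℝ (Fin 3) => ‖U z.1 z.2‖ ^ 2) volume)
    (hG2 : LocallyIntegrable (fun z : ℝ × EuclideanSpace ℝ (Fin 3) => frobeniusNormSq (G z.1 z.2)) volume)
    (hpq : ∀ K : Set (ℝ × EuclideanSpace ℝ (Fin 3)), IsCompact K →
      MemLp (uncurry p) (5 / 3) (volume.restrict K))
    (hUq : ∀ K : Set (ℝ × EuclideanSpace ℝ (Fin 3)), IsCompact K →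
      MemLp (uncurry U) (5 / 2) (volume.restrict K))
    (hStokes : IsDistributionalStokesSolutionOn (⊤ : Opens (ℝ × EuclideanSpace ℝ (Fin 3)))
      (fun s y => (U s y + W s y) + (G s y + fderiv ℝ (W s) y) y - G s y (W s y + V s y) -
        fderiv ℝ (W s) y (U s y + W s y))
      (fun s y => U s y + W s y) p)
    {ψ : ℝ → EuclideanSpace ℝ (Fin 3) → ℝ}
    (hψ : IsSpaceTimeTestOn (⊤ : Opens (ℝ × EuclideanSpace ℝ (Fin 3))) ψ) :
    Integrable (fun z : ℝ × EuclideanSpace ℝ (Fin 3) => (‖U z.1 z.2 + W z.1 z.2‖ ^ 2 / 2 +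
        frobeniusNormSq (G z.1 z.2 + fderiv ℝ (W z.1) z.2)) * ψ z.1 z.2) volume ∧
    Integrable (fun z : ℝ × EuclideanSpace ℝ (Fin 3) => (‖U z.1 z.2 + W z.1 z.2‖ ^ 2 / 2 *
          (timeDeriv ψ z.1 z.2 + Δ (ψ z.1) z.2) +
        (‖U z.1 z.2 + W z.1 z.2‖ ^ 2 / 2 * ⟪W z.1 z.2 + V z.1 z.2 - z.2, gradient (ψ z.1) z.2⟫ +
          p z.1 z.2 * ⟪U z.1 z.2 + W z.1 z.2, gradient (ψ z.1) z.2⟫) -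
        ⟪fderiv ℝ (W z.1) z.2 (U z.1 z.2 - V z.1 z.2), U z.1 z.2 + W z.1 z.2⟫ * ψ z.1 z.2)) volume ∧
    ∫ z : ℝ × EuclideanSpace ℝ (Fin 3), (‖U z.1 z.2 + W z.1 z.2‖ ^ 2 / 2 +
        frobeniusNormSq (G z.1 z.2 + fderiv ℝ (W z.1) z.2)) * ψ z.1 z.2 =
      ∫ z : ℝ × EuclideanSpace ℝ (Fin 3), (‖U z.1 z.2 + W z.1 z.2‖ ^ 2 / 2 *
          (timeDeriv ψ z.1 z.2 + Δ (ψ z.1) z.2) +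
        (‖U z.1 z.2 + W z.1 z.2‖ ^ 2 / 2 * ⟪W z.1 z.2 + V z.1 z.2 - z.2, gradient (ψ z.1) z.2⟫ +
          p z.1 z.2 * ⟪U z.1 z.2 + W z.1 z.2, gradient (ψ z.1) z.2⟫) -
        ⟪fderiv ℝ (W z.1) z.2 (U z.1 z.2 - V z.1 z.2), U z.1 z.2 + W z.1 z.2⟫ * ψ z.1 z.2) := by
  haveI := holderTriple_five_thirds_five_halves
  -- ## notation
  set u : ℝ → EuclideanSpace ℝ (Fin 3) → EuclideanSpace ℝ (Fin 3) := fun s y => U s y + W s y with hu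
  set Gu : ℝ → EuclideanSpace ℝ (Fin 3) → EuclideanSpace ℝ (Fin 3) →L[ℝ] EuclideanSpace ℝ (Fin 3) :=
    fun s y => G s y + fderiv ℝ (W s) y with hGu
  set b : ℝ → EuclideanSpace ℝ (Fin 3) → EuclideanSpace ℝ (Fin 3) := fun s y => W s y + V s y with hb
  set force : ℝ → EuclideanSpace ℝ (Fin 3) → EuclideanSpace ℝ (Fin 3) :=
    fun s y => (U s y + W s y) + (G s y + fderiv ℝ (W s) y) y - G s y (W s y + V s y) -
      fderiv ℝ (W s) y (U s y + W s y) with hforce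
  have hKQ : ∀ K : Set (ℝ × EuclideanSpace ℝ (Fin 3)),
      K ⊆ ((⊤ : Opens (ℝ × EuclideanSpace ℝ (Fin 3))) : Set (ℝ × EuclideanSpace ℝ (Fin 3))) :=
    fun _ _ _ => trivial
  -- ## the weak gradient of `u`
  have hWG : HasWeakSpatialGradientOn (⊤ : Opens (ℝ × EuclideanSpace ℝ (Fin 3))) W
      fun t x => fderiv ℝ (W t) x :=
    hasWeakSpatialGradientOn_of_contDiffOn isOpen_univ (fun _ _ => by simp)
      (by rw [univ_prod_univ]; exact hW.contDiffOn)
  have hGu' : HasWeakSpatialGradientOn (⊤ : Opens (ℝ × EuclideanSpace ℝ (Fin 3))) u Gu := hG.add hWG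
  -- ## continuity of the profile data, measurability
  have cW : Continuous fun z : ℝ × EuclideanSpace ℝ (Fin 3) => W z.1 z.2 := hW.continuous
  have cDW : Continuous fun z : ℝ × EuclideanSpace ℝ (Fin 3) => fderiv ℝ (W z.1) z.2 :=
    continuous_fderiv_slice hW
  have hUm : AEStronglyMeasurable (uncurry U) volume := by
    have h := hG.locallyIntegrableOn.aestronglyMeasurable
    rwa [TopologicalSpace.Opens.coe_top, Measure.restrict_univ] at h
  have hGm : AEStronglyMeasurable (uncurry G) volume := by
    have h := hG.locallyIntegrableOn_grad.aestronglyMeasurable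
    rwa [TopologicalSpace.Opens.coe_top, Measure.restrict_univ] at h
  have hum : AEStronglyMeasurable (uncurry u) volume := hUm.add cW.aestronglyMeasurable
  have hGum : AEStronglyMeasurable (uncurry Gu) volume := hGm.add cDW.aestronglyMeasurable
  have hbm : AEStronglyMeasurable (uncurry b) volume := cW.aestronglyMeasurable.add hVm
  have happ : Continuous (uncurry fun (L : EuclideanSpace ℝ (Fin 3) →L[ℝ] EuclideanSpace ℝ (Fin 3))
      (v : EuclideanSpace ℝ (Fin 3)) => L v) := isBoundedBilinearMap_apply.continuous
  -- ## the test function: support, bounds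
  set K : Set (ℝ × EuclideanSpace ℝ (Fin 3)) := tsupport (uncurry ψ) with hK_def
  have hK : IsCompact K := hψ.hasCompactSupport
  have hψ0 : ∀ z : ℝ × EuclideanSpace ℝ (Fin 3), z ∉ K →
      ψ z.1 z.2 = 0 ∧ gradient (ψ z.1) z.2 = 0 ∧ timeDeriv ψ z.1 z.2 = 0 ∧ Δ (ψ z.1) z.2 = 0 :=
    fun z hz => ⟨(weights_eq_zero_of_notMem_tsupport hz).1, (weights_eq_zero_of_notMem_tsupport hz).2.1,
      IsSpaceTimeTestOn.timeDeriv_eq_zero_of_notMem hz, laplacian_slice_eq_zero_of_notMem_tsupport hz⟩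
  obtain ⟨Cψ, Cg, hCψ0, hCg0, hCψ, hCg, cgψ⟩ := hψ.exists_bound_self_and_gradient
  have cψ : Continuous fun z : ℝ × EuclideanSpace ℝ (Fin 3) => ψ z.1 z.2 := hψ.contDiff.continuous
  have cψt : Continuous fun z : ℝ × EuclideanSpace ℝ (Fin 3) => timeDeriv ψ z.1 z.2 := hψ.timeDeriv_top.contDiff.continuous
  have cψL : Continuous fun z : ℝ × EuclideanSpace ℝ (Fin 3) => Δ (ψ z.1) z.2 := hψ.laplacian_top.contDiff.continuous
  -- bounds of `W`, `DW`, `y` on `K`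
  obtain ⟨R, hR⟩ := hK.isBounded.exists_norm_le
  obtain ⟨MW, hMW⟩ := hK.exists_bound_of_continuousOn cW.continuousOn
  obtain ⟨MD, hMD⟩ := hK.exists_bound_of_continuousOn cDW.continuousOn
  -- nonnegative versions of the bounds
  have hRz : ∀ z ∈ K, ‖z.2‖ ≤ |R| := fun z hz =>
    ((norm_snd_le z).trans (hR z hz)).trans (le_abs_self R)
  have hWz : ∀ z ∈ K, ‖W z.1 z.2‖ ≤ |MW| := fun z hz => (hMW z hz).trans (le_abs_self _)
  have hDz : ∀ z ∈ K, ‖fderiv ℝ (W z.1) z.2‖ ≤ |MD| := fun z hz => (hMD z hz).trans (le_abs_self _)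
  have hCV0 : 0 ≤ CV := (norm_nonneg _).trans (hVb 0 0)
  -- ## (A) local classes
  have hu2 : LocallyIntegrable (fun z : ℝ × EuclideanSpace ℝ (Fin 3) => ‖U z.1 z.2 + W z.1 z.2‖ ^ 2) volume := by
    refine locallyIntegrable_iff.2 fun K' hK' => ?_
    have h1 := hU2.integrableOn_isCompact hK'
    obtain ⟨M', hM'⟩ := hK'.exists_bound_of_continuousOn cW.continuousOn
    have hb' : IntegrableOn (fun _ : ℝ × EuclideanSpace ℝ (Fin 3) => (2 : ℝ) * M' ^ 2) K' volume :=
      integrableOn_const (hs := hK'.measure_lt_top.ne)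
    have hbd : IntegrableOn (fun z : ℝ × EuclideanSpace ℝ (Fin 3) => 2 * ‖U z.1 z.2‖ ^ 2 + 2 * M' ^ 2) K' volume :=
      (h1.const_mul 2).add hb'
    refine Integrable.mono' hbd ((hUm.add cW.aestronglyMeasurable).norm.pow 2).restrict ?_
    filter_upwards [ae_restrict_mem hK'.measurableSet] with z hz
    rw [Real.norm_eq_abs, abs_of_nonneg (by positivity)]
    have h := norm_add_le (U z.1 z.2) (W z.1 z.2)
    have h2 := hM' z hz
    show ‖U z.1 z.2 + W z.1 z.2‖ ^ 2 ≤ 2 * ‖U z.1 z.2‖ ^ 2 + 2 * M' ^ 2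
    nlinarith [norm_nonneg (U z.1 z.2 + W z.1 z.2), norm_nonneg (U z.1 z.2),
      norm_nonneg (W z.1 z.2), sq_nonneg (‖U z.1 z.2‖ - ‖W z.1 z.2‖)]
  have hGu2 : LocallyIntegrable (fun z : ℝ × EuclideanSpace ℝ (Fin 3) =>
      frobeniusNormSq (G z.1 z.2 + fderiv ℝ (W z.1) z.2)) volume := by
    refine locallyIntegrable_iff.2 fun K' hK' => ?_
    have h1 := hG2.integrableOn_isCompact hK'
    obtain ⟨MF, hMF⟩ := hK'.exists_bound_of_continuousOn
      (f := fun z : ℝ × EuclideanSpace ℝ (Fin 3) => frobeniusNormSq (fderiv ℝ (W z.1) z.2))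
      ((LerayHopfProofs.continuous_frobeniusNormSq.comp cDW).continuousOn)
    have hb' : IntegrableOn (fun _ : ℝ × EuclideanSpace ℝ (Fin 3) => (2 : ℝ) * MF) K' volume :=
      integrableOn_const (hs := hK'.measure_lt_top.ne)
    have hmeas : AEStronglyMeasurable (fun z : ℝ × EuclideanSpace ℝ (Fin 3) =>
        frobeniusNormSq (G z.1 z.2 + fderiv ℝ (W z.1) z.2)) (volume.restrict K') :=
      LerayHopfProofs.continuous_frobeniusNormSq.comp_aestronglyMeasurable
        (hGm.restrict.add cDW.aestronglyMeasurable.restrict)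
    have hbd : IntegrableOn (fun z : ℝ × EuclideanSpace ℝ (Fin 3) => 2 * frobeniusNormSq (G z.1 z.2) + 2 * MF) K' volume :=
      (h1.const_mul 2).add hb'
    refine Integrable.mono' hbd hmeas ?_
    filter_upwards [ae_restrict_mem hK'.measurableSet] with z hz
    rw [Real.norm_eq_abs, abs_of_nonneg (frobeniusNormSq_nonneg _)]
    have h := frobeniusNormSq_add_le (G z.1 z.2) (fderiv ℝ (W z.1) z.2)
    have h2 := hMF z hz
    rw [Real.norm_eq_abs, abs_of_nonneg (frobeniusNormSq_nonneg _)] at h2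
    linarith
  have L2u : ∀ K' : Set (ℝ × EuclideanSpace ℝ (Fin 3)), IsCompact K' → MemLp (uncurry fun s y => U s y + W s y) 2 (volume.restrict K') :=
    fun K' hK' => memLp_two_restrict_of_locallyIntegrableOn_sq (Q := ⊤) (by
      rw [TopologicalSpace.Opens.coe_top, Measure.restrict_univ]; exact hum) (hu2.locallyIntegrableOn _) hK' (hKQ K')
  have L2Gu : ∀ K' : Set (ℝ × EuclideanSpace ℝ (Fin 3)), IsCompact K' →
      MemLp (uncurry fun s y => G s y + fderiv ℝ (W s) y) 2 (volume.restrict K') := by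
    intro K' hK'
    refine memLp_two_of_frobeniusNormSq hGum.restrict ?_
    have hi := hGu2.integrableOn_isCompact hK'
    refine lt_of_le_of_lt (lintegral_mono fun z => ?_) hi.2
    simp only [uncurry]
    rw [← Real.enorm_eq_ofReal (frobeniusNormSq_nonneg _)]
  have L2G : ∀ K' : Set (ℝ × EuclideanSpace ℝ (Fin 3)), IsCompact K' → MemLp (uncurry G) 2 (volume.restrict K') := by
    intro K' hK'
    refine memLp_two_of_frobeniusNormSq hGm.restrict ?_
    have hi := hG2.integrableOn_isCompact hK'
    refine lt_of_le_of_lt (lintegral_mono fun z => ?_) hi.2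
    simp only [uncurry]
    rw [← Real.enorm_eq_ofReal (frobeniusNormSq_nonneg _)]
  have huq : ∀ K' : Set (ℝ × EuclideanSpace ℝ (Fin 3)), IsCompact K' → K' ⊆ ((⊤ : Opens (ℝ × EuclideanSpace ℝ (Fin 3))) : Set (ℝ × EuclideanSpace ℝ (Fin 3))) →
      MemLp (uncurry fun s y => U s y + W s y) (5 / 2) (volume.restrict K') := by
    intro K' hK' _
    haveI : IsFiniteMeasure (volume.restrict K') := isFiniteMeasure_restrict.2 hK'.measure_lt_top.ne
    obtain ⟨M', hM'⟩ := hK'.exists_bound_of_continuousOn cW.continuousOn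
    have hWK : MemLp (uncurry W) (5 / 2) (volume.restrict K') := by
      refine (memLp_top_of_bound cW.aestronglyMeasurable.restrict M' ?_).mono_exponent le_top
      filter_upwards [ae_restrict_mem hK'.measurableSet] with z hz
      exact hM' z hz
    exact (hUq K' hK').add hWK
  have hpq' : ∀ K' : Set (ℝ × EuclideanSpace ℝ (Fin 3)), IsCompact K' → K' ⊆ ((⊤ : Opens (ℝ × EuclideanSpace ℝ (Fin 3))) : Set (ℝ × EuclideanSpace ℝ (Fin 3))) →
      MemLp (uncurry p) (5 / 3) (volume.restrict K') := fun K' hK' _ => hpq K' hK'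
  have hforcem : AEStronglyMeasurable (uncurry fun s y =>
      (U s y + W s y) + (G s y + fderiv ℝ (W s) y) y - G s y (W s y + V s y) -
        fderiv ℝ (W s) y (U s y + W s y)) volume := by
    have m1 : AEStronglyMeasurable (fun z : ℝ × EuclideanSpace ℝ (Fin 3) => (G z.1 z.2 + fderiv ℝ (W z.1) z.2) z.2) volume :=
      happ.comp_aestronglyMeasurable (hGum.prodMk continuous_snd.aestronglyMeasurable)
    have m2 : AEStronglyMeasurable (fun z : ℝ × EuclideanSpace ℝ (Fin 3) => G z.1 z.2 (W z.1 z.2 + V z.1 z.2)) volume :=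
      happ.comp_aestronglyMeasurable (hGm.prodMk hbm)
    have m3 : AEStronglyMeasurable (fun z : ℝ × EuclideanSpace ℝ (Fin 3) => fderiv ℝ (W z.1) z.2 (U z.1 z.2 + W z.1 z.2)) volume :=
      happ.comp_aestronglyMeasurable (cDW.aestronglyMeasurable.prodMk hum)
    exact ((hum.add m1).sub m2).sub m3
  have hf2 : LocallyIntegrable (fun z : ℝ × EuclideanSpace ℝ (Fin 3) =>
      ‖(U z.1 z.2 + W z.1 z.2) + (G z.1 z.2 + fderiv ℝ (W z.1) z.2) z.2 - G z.1 z.2 (W z.1 z.2 + V z.1 z.2) -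
        fderiv ℝ (W z.1) z.2 (U z.1 z.2 + W z.1 z.2)‖ ^ 2) volume := by
    refine locallyIntegrable_iff.2 fun K' hK' => ?_
    haveI : IsFiniteMeasure (volume.restrict K') := isFiniteMeasure_restrict.2 hK'.measure_lt_top.ne
    obtain ⟨R', hR'⟩ := hK'.isBounded.exists_norm_le
    obtain ⟨M', hM'⟩ := hK'.exists_bound_of_continuousOn cW.continuousOn
    obtain ⟨D', hD'⟩ := hK'.exists_bound_of_continuousOn cDW.continuousOn
    have iu := hu2.integrableOn_isCompact hK'
    have iGu : IntegrableOn (fun z : ℝ × EuclideanSpace ℝ (Fin 3) => ‖G z.1 z.2 + fderiv ℝ (W z.1) z.2‖ ^ 2) K' volume :=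
      (memLp_two_iff_integrable_sq_norm (L2Gu K' hK').1).1 (L2Gu K' hK')
    have iG : IntegrableOn (fun z : ℝ × EuclideanSpace ℝ (Fin 3) => ‖G z.1 z.2‖ ^ 2) K' volume :=
      (memLp_two_iff_integrable_sq_norm (L2G K' hK').1).1 (L2G K' hK')
    have hbd : IntegrableOn (fun z : ℝ × EuclideanSpace ℝ (Fin 3) => 4 * ((1 + D' ^ 2) * ‖U z.1 z.2 + W z.1 z.2‖ ^ 2 +
        R' ^ 2 * ‖G z.1 z.2 + fderiv ℝ (W z.1) z.2‖ ^ 2 + (|M'| + CV) ^ 2 * ‖G z.1 z.2‖ ^ 2)) K' volume :=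
      (((iu.const_mul _).add (iGu.const_mul _)).add (iG.const_mul _)).const_mul _
    refine Integrable.mono' hbd (hforcem.norm.pow 2).restrict ?_
    filter_upwards [ae_restrict_mem hK'.measurableSet] with z hz
    rw [Real.norm_eq_abs, abs_of_nonneg (by positivity)]
    have nz : ‖z.2‖ ≤ R' := (norm_snd_le z).trans (hR' z hz)
    have e1 : ‖(G z.1 z.2 + fderiv ℝ (W z.1) z.2) z.2‖ ≤ ‖G z.1 z.2 + fderiv ℝ (W z.1) z.2‖ * R' :=
      (le_opNorm _ _).trans (mul_le_mul_of_nonneg_left nz (norm_nonneg _))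
    have e2 : ‖G z.1 z.2 (W z.1 z.2 + V z.1 z.2)‖ ≤ ‖G z.1 z.2‖ * (|M'| + CV) :=
      (le_opNorm _ _).trans (mul_le_mul_of_nonneg_left
        ((norm_add_le _ _).trans (add_le_add ((hM' z hz).trans (le_abs_self _)) (hVb _ _))) (norm_nonneg _))
    have e3 : ‖fderiv ℝ (W z.1) z.2 (U z.1 z.2 + W z.1 z.2)‖ ≤ D' * ‖U z.1 z.2 + W z.1 z.2‖ :=
      (le_opNorm _ _).trans (mul_le_mul_of_nonneg_right (hD' z hz) (norm_nonneg _))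
    have e4 := norm_sub_le ((U z.1 z.2 + W z.1 z.2) + (G z.1 z.2 + fderiv ℝ (W z.1) z.2) z.2 - G z.1 z.2 (W z.1 z.2 + V z.1 z.2))
      (fderiv ℝ (W z.1) z.2 (U z.1 z.2 + W z.1 z.2))
    have e5 := norm_sub_le ((U z.1 z.2 + W z.1 z.2) + (G z.1 z.2 + fderiv ℝ (W z.1) z.2) z.2)
      (G z.1 z.2 (W z.1 z.2 + V z.1 z.2))
    have e6 := norm_add_le (U z.1 z.2 + W z.1 z.2) ((G z.1 z.2 + fderiv ℝ (W z.1) z.2) z.2)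
    have hR'0 : 0 ≤ R' := (norm_nonneg _).trans (hR' z hz)
    have hD'0 : 0 ≤ D' := (norm_nonneg _).trans (hD' z hz)
    have hS : ‖U z.1 z.2 + W z.1 z.2 + (G z.1 z.2 + fderiv ℝ (W z.1) z.2) z.2 - (G z.1 z.2) (W z.1 z.2 + V z.1 z.2) -
          (fderiv ℝ (W z.1) z.2) (U z.1 z.2 + W z.1 z.2)‖ ≤
        ‖U z.1 z.2 + W z.1 z.2‖ + ‖(G z.1 z.2 + fderiv ℝ (W z.1) z.2) z.2‖ +
          ‖(G z.1 z.2) (W z.1 z.2 + V z.1 z.2)‖ + ‖(fderiv ℝ (W z.1) z.2) (U z.1 z.2 + W z.1 z.2)‖ := by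
      linarith
    have hS2 := pow_le_pow_left₀ (norm_nonneg _) hS 2
    have h4 : ∀ a₀ a₁ a₂ a₃ : ℝ, (a₀ + a₁ + a₂ + a₃) ^ 2 ≤ 4 * (a₀ ^ 2 + a₁ ^ 2 + a₂ ^ 2 + a₃ ^ 2) := by
      intro a₀ a₁ a₂ a₃
      nlinarith [sq_nonneg (a₀ - a₁), sq_nonneg (a₀ - a₂), sq_nonneg (a₀ - a₃), sq_nonneg (a₁ - a₂),
        sq_nonneg (a₁ - a₃), sq_nonneg (a₂ - a₃)]
    have h4' := h4 ‖U z.1 z.2 + W z.1 z.2‖ ‖(G z.1 z.2 + fderiv ℝ (W z.1) z.2) z.2‖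
      ‖(G z.1 z.2) (W z.1 z.2 + V z.1 z.2)‖ ‖(fderiv ℝ (W z.1) z.2) (U z.1 z.2 + W z.1 z.2)‖
    have hn1 := pow_le_pow_left₀ (norm_nonneg _) e1 2
    have hn2 := pow_le_pow_left₀ (norm_nonneg _) e2 2
    have hn3 := pow_le_pow_left₀ (norm_nonneg _) e3 2
    rw [mul_pow] at hn1 hn2 hn3
    nlinarith [hS2, h4', hn1, hn2, hn3, sq_nonneg D', sq_nonneg R',
      mul_nonneg (sq_nonneg D') (sq_nonneg ‖U z.1 z.2 + W z.1 z.2‖)]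
  -- ## (B) the local energy equality of the Stokes form
  have LEE := hStokes.local_energy_equality_holder (q := (5 / 3 : ℝ≥0∞)) (q' := (5 / 2 : ℝ≥0∞))
    (by rw [ENNReal.le_div_iff_mul_le (Or.inl (by norm_num)) (Or.inl (by norm_num))]; norm_num)
    (by rw [ENNReal.le_div_iff_mul_le (Or.inl (by norm_num)) (Or.inl (by norm_num))]; norm_num)
    (ENNReal.div_ne_top (by norm_num) (by norm_num)) (ENNReal.div_ne_top (by norm_num) (by norm_num))
    hGu' (hu2.locallyIntegrableOn _) (hGu2.locallyIntegrableOn _) hpq' huq (hf2.locallyIntegrableOn _) hψ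
  simp only [hu, hGu, hforce, TopologicalSpace.Opens.coe_top, Measure.restrict_univ] at LEE
  -- ## (C) the transport identities for `(u, ∇u)`
  have Tself := hGu'.integral_inner_apply_self_mul_eq (hu2.locallyIntegrableOn _)
    (hGu2.locallyIntegrableOn _) hψ
  simp only [hu, hGu, TopologicalSpace.Opens.coe_top, Measure.restrict_univ, finrank_euclideanSpace,
    Fintype.card_fin, Nat.cast_ofNat] at Tself
  have hWs : ∀ s, ContDiff ℝ 1 (W s) := fun s => hW.comp (contDiff_prodMk_right s)
  have hb1 : ∀ s, ContDiff ℝ 1 (b s) := fun s => (hWs s).add (hV1 s)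
  have hbdiv : ∀ᵐ z : ℝ × EuclideanSpace ℝ (Fin 3), VectorCalculus.divergence (b z.1) z.2 = 0 := by
    filter_upwards [hdivV] with z hz
    show VectorCalculus.divergence (W z.1 + V z.1) z.2 = 0
    have h := divergence_add_apply (v := W z.1) (w := V z.1) (x := z.2)
      (((hWs z.1).differentiable one_ne_zero) z.2) (((hV1 z.1).differentiable one_ne_zero) z.2)
    rw [hdivW z.1 z.2, hz, add_zero] at h
    exact h
  have hCb : ∀ᵐ z : ℝ × EuclideanSpace ℝ (Fin 3), z ∈ tsupport (uncurry ψ) → ‖b z.1 z.2‖ ≤ |MW| + CV :=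
    ae_of_all _ fun z hz => (norm_add_le _ _).trans (add_le_add (hWz z hz) (hVb _ _))
  have Tdrift := hGu'.integral_inner_apply_drift_mul_eq (hu2.locallyIntegrableOn _)
    (hGu2.locallyIntegrableOn _) hψ hb1 hbdiv hbm hCb
  simp only [hu, hGu, hb, TopologicalSpace.Opens.coe_top, Measure.restrict_univ] at Tdrift
  -- ## (D) integrability of the atoms (support in `K`)
  set μK : Measure (ℝ × EuclideanSpace ℝ (Fin 3)) := volume.restrict K with hμK
  haveI : IsFiniteMeasure μK := isFiniteMeasure_restrict.2 hK.measure_lt_top.ne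
  have huK : MemLp (uncurry fun s y => U s y + W s y) 2 μK := L2u K hK
  have hGuK : MemLp (uncurry fun s y => G s y + fderiv ℝ (W s) y) 2 μK := L2Gu K hK
  have iu2 : Integrable (fun z : ℝ × EuclideanSpace ℝ (Fin 3) => ‖U z.1 z.2 + W z.1 z.2‖ ^ 2) μK := hu2.integrableOn_isCompact hK
  have iu1 : Integrable (fun z : ℝ × EuclideanSpace ℝ (Fin 3) => ‖U z.1 z.2 + W z.1 z.2‖) μK := (huK.integrable one_le_two).norm
  have iF : Integrable (fun z : ℝ × EuclideanSpace ℝ (Fin 3) => frobeniusNormSq (G z.1 z.2 + fderiv ℝ (W z.1) z.2)) μK :=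
    hGu2.integrableOn_isCompact hK
  have hext : ∀ ⦃f : ℝ × EuclideanSpace ℝ (Fin 3) → ℝ⦄, (∀ z, z ∉ K → f z = 0) → Integrable f μK → Integrable f volume :=
    fun f hf0 hfi => IntegrableOn.integrable_of_forall_notMem_eq_zero hfi hf0
  -- a1 : `F(Gu) ψ`
  have a1 : Integrable (fun z : ℝ × EuclideanSpace ℝ (Fin 3) => frobeniusNormSq (G z.1 z.2 + fderiv ℝ (W z.1) z.2) * ψ z.1 z.2) volume := by
    refine hext (fun z hz => by rw [(hψ0 z hz).1, mul_zero]) ?_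
    exact iF.mul_bdd cψ.aestronglyMeasurable.restrict (ae_of_all _ fun z => hCψ z.1 z.2)
  -- a2 : `|u|² (∂ψ + Δψ)`
  obtain ⟨Ct, hCt⟩ := cψt.bounded_above_of_compact_support (hψ.timeDeriv_top).hasCompactSupport
  obtain ⟨CL, hCL⟩ := cψL.bounded_above_of_compact_support (hψ.laplacian_top).hasCompactSupport
  have a2 : Integrable (fun z : ℝ × EuclideanSpace ℝ (Fin 3) => ‖U z.1 z.2 + W z.1 z.2‖ ^ 2 *
      (timeDeriv ψ z.1 z.2 + Δ (ψ z.1) z.2)) volume := by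
    refine hext (fun z hz => by rw [(hψ0 z hz).2.2.1, (hψ0 z hz).2.2.2, add_zero, mul_zero]) ?_
    refine iu2.mul_bdd (cψt.add cψL).aestronglyMeasurable.restrict (c := Ct + CL) (ae_of_all _ fun z => ?_)
    exact (norm_add_le _ _).trans (add_le_add (hCt z) (hCL z))
  -- a3 : `p ⟪u, ∇ψ⟫`
  have a3 : Integrable (fun z : ℝ × EuclideanSpace ℝ (Fin 3) => p z.1 z.2 * ⟪U z.1 z.2 + W z.1 z.2, gradient (ψ z.1) z.2⟫) volume := by
    refine hext (fun z hz => by rw [(hψ0 z hz).2.1, inner_zero_right, mul_zero]) ?_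
    have hug : MemLp (fun z : ℝ × EuclideanSpace ℝ (Fin 3) => ⟪U z.1 z.2 + W z.1 z.2, gradient (ψ z.1) z.2⟫) (5 / 2) μK := by
      refine (huq K hK (hKQ K)).of_le_mul (c := Cg) (hum.restrict.inner cgψ.aestronglyMeasurable.restrict)
        (ae_of_all _ fun z => ?_)
      calc ‖⟪U z.1 z.2 + W z.1 z.2, gradient (ψ z.1) z.2⟫‖ ≤ ‖U z.1 z.2 + W z.1 z.2‖ * ‖gradient (ψ z.1) z.2‖ :=
            norm_inner_le_norm _ _
        _ ≤ Cg * ‖uncurry (fun s y => U s y + W s y) z‖ := by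
            rw [mul_comm]; exact mul_le_mul_of_nonneg_right (hCg z.1 z.2) (norm_nonneg _)
    have h := (hpq K hK).integrable_mul hug
    exact h
  -- a4 : `⟪force, u⟫ ψ`
  have hforceK : MemLp (uncurry fun s y => (U s y + W s y) + (G s y + fderiv ℝ (W s) y) y - G s y (W s y + V s y) -
      fderiv ℝ (W s) y (U s y + W s y)) 2 μK :=
    (memLp_two_iff_integrable_sq_norm hforcem.restrict).2 (hf2.integrableOn_isCompact hK)
  have a4 : Integrable (fun z : ℝ × EuclideanSpace ℝ (Fin 3) => ⟪(U z.1 z.2 + W z.1 z.2) + (G z.1 z.2 + fderiv ℝ (W z.1) z.2) z.2 -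
      G z.1 z.2 (W z.1 z.2 + V z.1 z.2) - fderiv ℝ (W z.1) z.2 (U z.1 z.2 + W z.1 z.2), U z.1 z.2 + W z.1 z.2⟫ *
        ψ z.1 z.2) volume := by
    refine hext (fun z hz => by rw [(hψ0 z hz).1, mul_zero]) ?_
    have h := integrable_bilin_of_memLp (p := 2) (q := 2) (innerSL ℝ (E := EuclideanSpace ℝ (Fin 3))) hforceK huK
    exact h.mul_bdd cψ.aestronglyMeasurable.restrict (ae_of_all _ fun z => hCψ z.1 z.2)
  -- a5 : `|u|² ψ`
  have a5 : Integrable (fun z : ℝ × EuclideanSpace ℝ (Fin 3) => ‖U z.1 z.2 + W z.1 z.2‖ ^ 2 * ψ z.1 z.2) volume := by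
    refine hext (fun z hz => by rw [(hψ0 z hz).1, mul_zero]) ?_
    exact iu2.mul_bdd cψ.aestronglyMeasurable.restrict (ae_of_all _ fun z => hCψ z.1 z.2)
  -- a6 : `|u|² ⟪y, ∇ψ⟫`
  have a6 : Integrable (fun z : ℝ × EuclideanSpace ℝ (Fin 3) => ‖U z.1 z.2 + W z.1 z.2‖ ^ 2 * ⟪z.2, gradient (ψ z.1) z.2⟫) volume := by
    refine hext (fun z hz => by rw [(hψ0 z hz).2.1, inner_zero_right, mul_zero]) ?_
    refine iu2.mul_bdd (continuous_snd.inner cgψ).aestronglyMeasurable.restrict (c := |R| * Cg) ?_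
    filter_upwards [ae_restrict_mem hK.measurableSet] with z hz
    calc ‖⟪z.2, gradient (ψ z.1) z.2⟫‖ ≤ ‖z.2‖ * ‖gradient (ψ z.1) z.2‖ := norm_inner_le_norm _ _
      _ ≤ |R| * Cg := mul_le_mul (hRz z hz) (hCg z.1 z.2) (norm_nonneg _) (abs_nonneg _)
  -- a7 : `|u|² ⟪b, ∇ψ⟫`
  have a7 : Integrable (fun z : ℝ × EuclideanSpace ℝ (Fin 3) => ‖U z.1 z.2 + W z.1 z.2‖ ^ 2 *
      ⟪W z.1 z.2 + V z.1 z.2, gradient (ψ z.1) z.2⟫) volume := by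
    refine hext (fun z hz => by rw [(hψ0 z hz).2.1, inner_zero_right, mul_zero]) ?_
    refine iu2.mul_bdd (hbm.inner cgψ.aestronglyMeasurable).restrict (c := (|MW| + CV) * Cg) ?_
    filter_upwards [ae_restrict_mem hK.measurableSet] with z hz
    calc ‖⟪W z.1 z.2 + V z.1 z.2, gradient (ψ z.1) z.2⟫‖ ≤ ‖W z.1 z.2 + V z.1 z.2‖ * ‖gradient (ψ z.1) z.2‖ :=
          norm_inner_le_norm _ _
      _ ≤ (|MW| + CV) * Cg := mul_le_mul ((norm_add_le _ _).trans (add_le_add (hWz z hz) (hVb _ _)))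
          (hCg z.1 z.2) (norm_nonneg _) (by positivity)
  -- a8 : `⟪DW b, u⟫ ψ`
  have a8 : Integrable (fun z : ℝ × EuclideanSpace ℝ (Fin 3) => ⟪fderiv ℝ (W z.1) z.2 (W z.1 z.2 + V z.1 z.2), U z.1 z.2 + W z.1 z.2⟫ *
      ψ z.1 z.2) volume := by
    refine hext (fun z hz => by rw [(hψ0 z hz).1, mul_zero]) ?_
    have hmeas : AEStronglyMeasurable (fun z : ℝ × EuclideanSpace ℝ (Fin 3) =>
        ⟪fderiv ℝ (W z.1) z.2 (W z.1 z.2 + V z.1 z.2), U z.1 z.2 + W z.1 z.2⟫ * ψ z.1 z.2) μK :=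
      ((happ.comp_aestronglyMeasurable (cDW.aestronglyMeasurable.prodMk hbm)).inner hum).restrict.mul
        cψ.aestronglyMeasurable.restrict
    refine Integrable.mono' (iu1.const_mul (|MD| * (|MW| + CV) * Cψ)) hmeas ?_
    filter_upwards [ae_restrict_mem hK.measurableSet] with z hz
    rw [norm_mul]
    calc ‖⟪fderiv ℝ (W z.1) z.2 (W z.1 z.2 + V z.1 z.2), U z.1 z.2 + W z.1 z.2⟫‖ * ‖ψ z.1 z.2‖
        ≤ (‖fderiv ℝ (W z.1) z.2 (W z.1 z.2 + V z.1 z.2)‖ * ‖U z.1 z.2 + W z.1 z.2‖) * Cψ :=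
          mul_le_mul (norm_inner_le_norm _ _) (hCψ z.1 z.2) (norm_nonneg _) (by positivity)
      _ ≤ (|MD| * (|MW| + CV) * ‖U z.1 z.2 + W z.1 z.2‖) * Cψ := by
          gcongr
          exact (le_opNorm _ _).trans (mul_le_mul (hDz z hz)
            ((norm_add_le _ _).trans (add_le_add (hWz z hz) (hVb _ _))) (norm_nonneg _) (abs_nonneg _))
      _ = |MD| * (|MW| + CV) * Cψ * ‖U z.1 z.2 + W z.1 z.2‖ := by ring
  -- a9 : `⟪DW u, u⟫ ψ`
  have a9 : Integrable (fun z : ℝ × EuclideanSpace ℝ (Fin 3) => ⟪fderiv ℝ (W z.1) z.2 (U z.1 z.2 + W z.1 z.2), U z.1 z.2 + W z.1 z.2⟫ *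
      ψ z.1 z.2) volume := by
    refine hext (fun z hz => by rw [(hψ0 z hz).1, mul_zero]) ?_
    have hmeas : AEStronglyMeasurable (fun z : ℝ × EuclideanSpace ℝ (Fin 3) =>
        ⟪fderiv ℝ (W z.1) z.2 (U z.1 z.2 + W z.1 z.2), U z.1 z.2 + W z.1 z.2⟫ * ψ z.1 z.2) μK :=
      ((happ.comp_aestronglyMeasurable (cDW.aestronglyMeasurable.prodMk hum)).inner hum).restrict.mul
        cψ.aestronglyMeasurable.restrict
    refine Integrable.mono' (iu2.const_mul (|MD| * Cψ)) hmeas ?_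
    filter_upwards [ae_restrict_mem hK.measurableSet] with z hz
    rw [norm_mul]
    calc ‖⟪fderiv ℝ (W z.1) z.2 (U z.1 z.2 + W z.1 z.2), U z.1 z.2 + W z.1 z.2⟫‖ * ‖ψ z.1 z.2‖
        ≤ (‖fderiv ℝ (W z.1) z.2 (U z.1 z.2 + W z.1 z.2)‖ * ‖U z.1 z.2 + W z.1 z.2‖) * Cψ :=
          mul_le_mul (norm_inner_le_norm _ _) (hCψ z.1 z.2) (norm_nonneg _) (by positivity)
      _ ≤ (|MD| * ‖U z.1 z.2 + W z.1 z.2‖ * ‖U z.1 z.2 + W z.1 z.2‖) * Cψ := by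
          gcongr
          exact (le_opNorm _ _).trans (mul_le_mul_of_nonneg_right (hDz z hz) (norm_nonneg _))
      _ = |MD| * Cψ * ‖U z.1 z.2 + W z.1 z.2‖ ^ 2 := by ring
  -- a10 : `⟪Gu y, u⟫ ψ`
  have hGuyK : MemLp (fun z : ℝ × EuclideanSpace ℝ (Fin 3) => (G z.1 z.2 + fderiv ℝ (W z.1) z.2) z.2) 2 μK := by
    refine hGuK.of_le_mul (c := |R|) (happ.comp_aestronglyMeasurable
      (hGum.prodMk continuous_snd.aestronglyMeasurable)).restrict ?_
    filter_upwards [ae_restrict_mem hK.measurableSet] with z hz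
    calc ‖(G z.1 z.2 + fderiv ℝ (W z.1) z.2) z.2‖ ≤ ‖G z.1 z.2 + fderiv ℝ (W z.1) z.2‖ * ‖z.2‖ := le_opNorm _ _
      _ ≤ |R| * ‖uncurry (fun s y => G s y + fderiv ℝ (W s) y) z‖ := by
          rw [mul_comm]; exact mul_le_mul_of_nonneg_right (hRz z hz) (norm_nonneg _)
  have a10 : Integrable (fun z : ℝ × EuclideanSpace ℝ (Fin 3) => ⟪(G z.1 z.2 + fderiv ℝ (W z.1) z.2) z.2, U z.1 z.2 + W z.1 z.2⟫ *
      ψ z.1 z.2) volume := by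
    refine hext (fun z hz => by rw [(hψ0 z hz).1, mul_zero]) ?_
    have h := integrable_bilin_of_memLp (p := 2) (q := 2) (innerSL ℝ (E := EuclideanSpace ℝ (Fin 3))) hGuyK huK
    exact h.mul_bdd cψ.aestronglyMeasurable.restrict (ae_of_all _ fun z => hCψ z.1 z.2)
  -- a12 : `⟪Gu b, u⟫ ψ`
  have hGubK : MemLp (fun z : ℝ × EuclideanSpace ℝ (Fin 3) => (G z.1 z.2 + fderiv ℝ (W z.1) z.2) (W z.1 z.2 + V z.1 z.2)) 2 μK := by
    refine hGuK.of_le_mul (c := |MW| + CV) (happ.comp_aestronglyMeasurable (hGum.prodMk hbm)).restrict ?_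
    filter_upwards [ae_restrict_mem hK.measurableSet] with z hz
    calc ‖(G z.1 z.2 + fderiv ℝ (W z.1) z.2) (W z.1 z.2 + V z.1 z.2)‖
        ≤ ‖G z.1 z.2 + fderiv ℝ (W z.1) z.2‖ * ‖W z.1 z.2 + V z.1 z.2‖ := le_opNorm _ _
      _ ≤ (|MW| + CV) * ‖uncurry (fun s y => G s y + fderiv ℝ (W s) y) z‖ := by
          rw [mul_comm]
          exact mul_le_mul_of_nonneg_right ((norm_add_le _ _).trans (add_le_add (hWz z hz) (hVb _ _)))
            (norm_nonneg _)
  have a12 : Integrable (fun z : ℝ × EuclideanSpace ℝ (Fin 3) => ⟪(G z.1 z.2 + fderiv ℝ (W z.1) z.2) (W z.1 z.2 + V z.1 z.2),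
      U z.1 z.2 + W z.1 z.2⟫ * ψ z.1 z.2) volume := by
    refine hext (fun z hz => by rw [(hψ0 z hz).1, mul_zero]) ?_
    have h := integrable_bilin_of_memLp (p := 2) (q := 2) (innerSL ℝ (E := EuclideanSpace ℝ (Fin 3))) hGubK huK
    exact h.mul_bdd cψ.aestronglyMeasurable.restrict (ae_of_all _ fun z => hCψ z.1 z.2)
  -- ## (E) the identities between the atoms
  -- the force term
  have eF : ∫ z : ℝ × EuclideanSpace ℝ (Fin 3), ⟪(U z.1 z.2 + W z.1 z.2) + (G z.1 z.2 + fderiv ℝ (W z.1) z.2) z.2 -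
        G z.1 z.2 (W z.1 z.2 + V z.1 z.2) - fderiv ℝ (W z.1) z.2 (U z.1 z.2 + W z.1 z.2), U z.1 z.2 + W z.1 z.2⟫ *
          ψ z.1 z.2 =
      (∫ z : ℝ × EuclideanSpace ℝ (Fin 3), ‖U z.1 z.2 + W z.1 z.2‖ ^ 2 * ψ z.1 z.2) +
        (∫ z : ℝ × EuclideanSpace ℝ (Fin 3), ⟪(G z.1 z.2 + fderiv ℝ (W z.1) z.2) z.2, U z.1 z.2 + W z.1 z.2⟫ * ψ z.1 z.2) -
        (∫ z : ℝ × EuclideanSpace ℝ (Fin 3), ⟪(G z.1 z.2 + fderiv ℝ (W z.1) z.2) (W z.1 z.2 + V z.1 z.2), U z.1 z.2 + W z.1 z.2⟫ * ψ z.1 z.2) +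
        (∫ z : ℝ × EuclideanSpace ℝ (Fin 3), ⟪fderiv ℝ (W z.1) z.2 (W z.1 z.2 + V z.1 z.2), U z.1 z.2 + W z.1 z.2⟫ * ψ z.1 z.2) -
        ∫ z : ℝ × EuclideanSpace ℝ (Fin 3), ⟪fderiv ℝ (W z.1) z.2 (U z.1 z.2 + W z.1 z.2), U z.1 z.2 + W z.1 z.2⟫ * ψ z.1 z.2 := by
    have s1 : Integrable (fun z : ℝ × EuclideanSpace ℝ (Fin 3) => ‖U z.1 z.2 + W z.1 z.2‖ ^ 2 * ψ z.1 z.2 +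
        ⟪(G z.1 z.2 + fderiv ℝ (W z.1) z.2) z.2, U z.1 z.2 + W z.1 z.2⟫ * ψ z.1 z.2) volume := a5.add a10
    have s2 : Integrable (fun z : ℝ × EuclideanSpace ℝ (Fin 3) => ‖U z.1 z.2 + W z.1 z.2‖ ^ 2 * ψ z.1 z.2 +
        ⟪(G z.1 z.2 + fderiv ℝ (W z.1) z.2) z.2, U z.1 z.2 + W z.1 z.2⟫ * ψ z.1 z.2 -
        ⟪(G z.1 z.2 + fderiv ℝ (W z.1) z.2) (W z.1 z.2 + V z.1 z.2), U z.1 z.2 + W z.1 z.2⟫ * ψ z.1 z.2) volume := s1.sub a12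
    have s3 : Integrable (fun z : ℝ × EuclideanSpace ℝ (Fin 3) => ‖U z.1 z.2 + W z.1 z.2‖ ^ 2 * ψ z.1 z.2 +
        ⟪(G z.1 z.2 + fderiv ℝ (W z.1) z.2) z.2, U z.1 z.2 + W z.1 z.2⟫ * ψ z.1 z.2 -
        ⟪(G z.1 z.2 + fderiv ℝ (W z.1) z.2) (W z.1 z.2 + V z.1 z.2), U z.1 z.2 + W z.1 z.2⟫ * ψ z.1 z.2 +
        ⟪fderiv ℝ (W z.1) z.2 (W z.1 z.2 + V z.1 z.2), U z.1 z.2 + W z.1 z.2⟫ * ψ z.1 z.2) volume := s2.add a8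
    rw [← integral_add a5 a10, ← integral_sub s1 a12, ← integral_add s2 a8, ← integral_sub s3 a9]
    refine integral_congr_ae (ae_of_all _ fun z => ?_)
    dsimp only
    rw [← real_inner_self_eq_norm_sq (U z.1 z.2 + W z.1 z.2)]
    simp only [inner_sub_left, inner_add_left, FunLike.coe_add, Pi.add_apply, map_add]
    ring
  -- the dilation identity, split
  have eJ : ∫ z : ℝ × EuclideanSpace ℝ (Fin 3), ‖U z.1 z.2 + W z.1 z.2‖ ^ 2 * (3 * ψ z.1 z.2 + ⟪z.2, gradient (ψ z.1) z.2⟫) =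
      3 * (∫ z : ℝ × EuclideanSpace ℝ (Fin 3), ‖U z.1 z.2 + W z.1 z.2‖ ^ 2 * ψ z.1 z.2) +
        ∫ z : ℝ × EuclideanSpace ℝ (Fin 3), ‖U z.1 z.2 + W z.1 z.2‖ ^ 2 * ⟪z.2, gradient (ψ z.1) z.2⟫ := by
    rw [← integral_const_mul, ← integral_add (a5.const_mul 3) a6]
    refine integral_congr_ae (ae_of_all _ fun z => ?_)
    dsimp only
    ring
  -- the right-hand side of the local energy equality, split
  have eLEE : ∫ z : ℝ × EuclideanSpace ℝ (Fin 3), (‖U z.1 z.2 + W z.1 z.2‖ ^ 2 * (timeDeriv ψ z.1 z.2 + Δ (ψ z.1) z.2) +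
        2 * (p z.1 z.2 * ⟪U z.1 z.2 + W z.1 z.2, gradient (ψ z.1) z.2⟫) +
        2 * (⟪(U z.1 z.2 + W z.1 z.2) + (G z.1 z.2 + fderiv ℝ (W z.1) z.2) z.2 -
          G z.1 z.2 (W z.1 z.2 + V z.1 z.2) - fderiv ℝ (W z.1) z.2 (U z.1 z.2 + W z.1 z.2), U z.1 z.2 + W z.1 z.2⟫ *
            ψ z.1 z.2)) =
      (∫ z : ℝ × EuclideanSpace ℝ (Fin 3), ‖U z.1 z.2 + W z.1 z.2‖ ^ 2 * (timeDeriv ψ z.1 z.2 + Δ (ψ z.1) z.2)) +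
        2 * (∫ z : ℝ × EuclideanSpace ℝ (Fin 3), p z.1 z.2 * ⟪U z.1 z.2 + W z.1 z.2, gradient (ψ z.1) z.2⟫) +
        2 * ∫ z : ℝ × EuclideanSpace ℝ (Fin 3), ⟪(U z.1 z.2 + W z.1 z.2) + (G z.1 z.2 + fderiv ℝ (W z.1) z.2) z.2 -
          G z.1 z.2 (W z.1 z.2 + V z.1 z.2) - fderiv ℝ (W z.1) z.2 (U z.1 z.2 + W z.1 z.2), U z.1 z.2 + W z.1 z.2⟫ *
            ψ z.1 z.2 := by
    have t1 : Integrable (fun z : ℝ × EuclideanSpace ℝ (Fin 3) => 2 * (p z.1 z.2 * ⟪U z.1 z.2 + W z.1 z.2, gradient (ψ z.1) z.2⟫)) volume := a3.const_mul 2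
    have t2 : Integrable (fun z : ℝ × EuclideanSpace ℝ (Fin 3) => ‖U z.1 z.2 + W z.1 z.2‖ ^ 2 * (timeDeriv ψ z.1 z.2 + Δ (ψ z.1) z.2) +
        2 * (p z.1 z.2 * ⟪U z.1 z.2 + W z.1 z.2, gradient (ψ z.1) z.2⟫)) volume := a2.add t1
    rw [← integral_const_mul, ← integral_const_mul, ← integral_add a2 t1, ← integral_add t2 (a4.const_mul 2)]
  -- the two sides of the balance
  have eLHS : ∫ z : ℝ × EuclideanSpace ℝ (Fin 3), (‖U z.1 z.2 + W z.1 z.2‖ ^ 2 / 2 + frobeniusNormSq (G z.1 z.2 + fderiv ℝ (W z.1) z.2)) *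
        ψ z.1 z.2 =
      1 / 2 * (∫ z : ℝ × EuclideanSpace ℝ (Fin 3), ‖U z.1 z.2 + W z.1 z.2‖ ^ 2 * ψ z.1 z.2) +
        ∫ z : ℝ × EuclideanSpace ℝ (Fin 3), frobeniusNormSq (G z.1 z.2 + fderiv ℝ (W z.1) z.2) * ψ z.1 z.2 := by
    rw [← integral_const_mul, ← integral_add (a5.const_mul _) a1]
    refine integral_congr_ae (ae_of_all _ fun z => ?_)
    dsimp only
    ring
  have eRHS : ∫ z : ℝ × EuclideanSpace ℝ (Fin 3), (‖U z.1 z.2 + W z.1 z.2‖ ^ 2 / 2 * (timeDeriv ψ z.1 z.2 + Δ (ψ z.1) z.2) +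
        (‖U z.1 z.2 + W z.1 z.2‖ ^ 2 / 2 * ⟪W z.1 z.2 + V z.1 z.2 - z.2, gradient (ψ z.1) z.2⟫ +
          p z.1 z.2 * ⟪U z.1 z.2 + W z.1 z.2, gradient (ψ z.1) z.2⟫) -
        ⟪fderiv ℝ (W z.1) z.2 (U z.1 z.2 - V z.1 z.2), U z.1 z.2 + W z.1 z.2⟫ * ψ z.1 z.2) =
      1 / 2 * (∫ z : ℝ × EuclideanSpace ℝ (Fin 3), ‖U z.1 z.2 + W z.1 z.2‖ ^ 2 * (timeDeriv ψ z.1 z.2 + Δ (ψ z.1) z.2)) +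
        (1 / 2 * (∫ z : ℝ × EuclideanSpace ℝ (Fin 3), ‖U z.1 z.2 + W z.1 z.2‖ ^ 2 * ⟪W z.1 z.2 + V z.1 z.2, gradient (ψ z.1) z.2⟫) -
          1 / 2 * (∫ z : ℝ × EuclideanSpace ℝ (Fin 3), ‖U z.1 z.2 + W z.1 z.2‖ ^ 2 * ⟪z.2, gradient (ψ z.1) z.2⟫) +
          ∫ z : ℝ × EuclideanSpace ℝ (Fin 3), p z.1 z.2 * ⟪U z.1 z.2 + W z.1 z.2, gradient (ψ z.1) z.2⟫) -
        ((∫ z : ℝ × EuclideanSpace ℝ (Fin 3), ⟪fderiv ℝ (W z.1) z.2 (U z.1 z.2 + W z.1 z.2), U z.1 z.2 + W z.1 z.2⟫ * ψ z.1 z.2) -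
          ∫ z : ℝ × EuclideanSpace ℝ (Fin 3), ⟪fderiv ℝ (W z.1) z.2 (W z.1 z.2 + V z.1 z.2), U z.1 z.2 + W z.1 z.2⟫ * ψ z.1 z.2) := by
    have i1 := a2.const_mul (1 / 2 : ℝ)
    have i2 := a7.const_mul (1 / 2 : ℝ)
    have i3 := a6.const_mul (1 / 2 : ℝ)
    have i23 : Integrable (fun z : ℝ × EuclideanSpace ℝ (Fin 3) => 1 / 2 * (‖U z.1 z.2 + W z.1 z.2‖ ^ 2 *
        ⟪W z.1 z.2 + V z.1 z.2, gradient (ψ z.1) z.2⟫) -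
        1 / 2 * (‖U z.1 z.2 + W z.1 z.2‖ ^ 2 * ⟪z.2, gradient (ψ z.1) z.2⟫)) volume := i2.sub i3
    have i234 : Integrable (fun z : ℝ × EuclideanSpace ℝ (Fin 3) => 1 / 2 * (‖U z.1 z.2 + W z.1 z.2‖ ^ 2 *
        ⟪W z.1 z.2 + V z.1 z.2, gradient (ψ z.1) z.2⟫) -
        1 / 2 * (‖U z.1 z.2 + W z.1 z.2‖ ^ 2 * ⟪z.2, gradient (ψ z.1) z.2⟫) +
        p z.1 z.2 * ⟪U z.1 z.2 + W z.1 z.2, gradient (ψ z.1) z.2⟫) volume := i23.add a3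
    have i98 : Integrable (fun z : ℝ × EuclideanSpace ℝ (Fin 3) => ⟪fderiv ℝ (W z.1) z.2 (U z.1 z.2 + W z.1 z.2), U z.1 z.2 + W z.1 z.2⟫ *
        ψ z.1 z.2 - ⟪fderiv ℝ (W z.1) z.2 (W z.1 z.2 + V z.1 z.2), U z.1 z.2 + W z.1 z.2⟫ * ψ z.1 z.2) volume :=
      a9.sub a8
    have i1234 : Integrable (fun z : ℝ × EuclideanSpace ℝ (Fin 3) => 1 / 2 * (‖U z.1 z.2 + W z.1 z.2‖ ^ 2 *
        (timeDeriv ψ z.1 z.2 + Δ (ψ z.1) z.2)) + (1 / 2 * (‖U z.1 z.2 + W z.1 z.2‖ ^ 2 *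
        ⟪W z.1 z.2 + V z.1 z.2, gradient (ψ z.1) z.2⟫) -
        1 / 2 * (‖U z.1 z.2 + W z.1 z.2‖ ^ 2 * ⟪z.2, gradient (ψ z.1) z.2⟫) +
        p z.1 z.2 * ⟪U z.1 z.2 + W z.1 z.2, gradient (ψ z.1) z.2⟫)) volume := i1.add i234
    rw [← integral_const_mul, ← integral_const_mul, ← integral_const_mul, ← integral_sub i2 i3,
      ← integral_add i23 a3, ← integral_sub a9 a8, ← integral_add i1 i234, ← integral_sub i1234 i98]
    refine integral_congr_ae (ae_of_all _ fun z => ?_)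
    dsimp only
    have ev : U z.1 z.2 - V z.1 z.2 = (U z.1 z.2 + W z.1 z.2) - (W z.1 z.2 + V z.1 z.2) := by abel
    rw [ev, map_sub, inner_sub_left, inner_sub_left]
    ring
  -- ## (F) integrability of the two sides and the conclusion
  have iL : Integrable (fun z : ℝ × EuclideanSpace ℝ (Fin 3) => (‖U z.1 z.2 + W z.1 z.2‖ ^ 2 / 2 +
        frobeniusNormSq (G z.1 z.2 + fderiv ℝ (W z.1) z.2)) * ψ z.1 z.2) volume := by
    refine ((a5.const_mul (1 / 2 : ℝ)).add a1).congr (ae_of_all _ fun z => ?_)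
    simp only [Pi.add_apply]
    ring
  have iR : Integrable (fun z : ℝ × EuclideanSpace ℝ (Fin 3) => (‖U z.1 z.2 + W z.1 z.2‖ ^ 2 / 2 *
          (timeDeriv ψ z.1 z.2 + Δ (ψ z.1) z.2) +
        (‖U z.1 z.2 + W z.1 z.2‖ ^ 2 / 2 * ⟪W z.1 z.2 + V z.1 z.2 - z.2, gradient (ψ z.1) z.2⟫ +
          p z.1 z.2 * ⟪U z.1 z.2 + W z.1 z.2, gradient (ψ z.1) z.2⟫) -
        ⟪fderiv ℝ (W z.1) z.2 (U z.1 z.2 - V z.1 z.2), U z.1 z.2 + W z.1 z.2⟫ * ψ z.1 z.2)) volume := by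
    have j1 := a2.const_mul (1 / 2 : ℝ)
    have j2 := a7.const_mul (1 / 2 : ℝ)
    have j3 := a6.const_mul (1 / 2 : ℝ)
    refine ((((j1.add j2).sub j3).add a3).sub (a9.sub a8)).congr (ae_of_all _ fun z => ?_)
    simp only [Pi.add_apply, Pi.sub_apply]
    have ev : U z.1 z.2 - V z.1 z.2 = (U z.1 z.2 + W z.1 z.2) - (W z.1 z.2 + V z.1 z.2) := by abel
    rw [ev, map_sub, inner_sub_left, inner_sub_left]
    ring
  refine ⟨iL, iR, ?_⟩
  rw [eLHS, eRHS]
  rw [eLEE] at LEE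
  linarith [LEE, eF, eJ, Tself, Tdrift]

/-- **Clause (iv) of `IsMollifiedPeriodicWeakSolution.weakForm` from the Stokes form** — the
iterated-integral form of `local_energy_balance_eq` (Fubini), as an inequality (in fact an
equality) for every test function `ψ` (the clause asks it for `ψ ≥ 0`; with `V = η_ε * U`). [cite: BradshawTsai2017AHP, proof of Thm 2.4 (local energy equality of the approximants)] -/
theorem local_energy_balance_iterated (hW : ContDiff ℝ 1 (uncurry W))
    (hdivW : ∀ s, VectorCalculus.IsDivFree (W s))
    (hV1 : ∀ s, ContDiff ℝ 1 (V s)) (hVm : AEStronglyMeasurable (uncurry V) volume) {CV : ℝ}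
    (hVb : ∀ s y, ‖V s y‖ ≤ CV)
    (hdivV : ∀ᵐ z : ℝ × EuclideanSpace ℝ (Fin 3), VectorCalculus.divergence (V z.1) z.2 = 0)
    (hG : HasWeakSpatialGradientOn (⊤ : Opens (ℝ × EuclideanSpace ℝ (Fin 3))) U G)
    (hU2 : LocallyIntegrable (fun z : ℝ × EuclideanSpace ℝ (Fin 3) => ‖U z.1 z.2‖ ^ 2) volume)
    (hG2 : LocallyIntegrable (fun z : ℝ × EuclideanSpace ℝ (Fin 3) => frobeniusNormSq (G z.1 z.2)) volume)
    (hpq : ∀ K : Set (ℝ × EuclideanSpace ℝ (Fin 3)), IsCompact K → MemLp (uncurry p) (5 / 3) (volume.restrict K))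
    (hUq : ∀ K : Set (ℝ × EuclideanSpace ℝ (Fin 3)), IsCompact K → MemLp (uncurry U) (5 / 2) (volume.restrict K))
    (hStokes : IsDistributionalStokesSolutionOn (⊤ : Opens (ℝ × EuclideanSpace ℝ (Fin 3)))
      (fun s y => (U s y + W s y) + (G s y + fderiv ℝ (W s) y) y - G s y (W s y + V s y) -
        fderiv ℝ (W s) y (U s y + W s y))
      (fun s y => U s y + W s y) p)
    {ψ : ℝ → EuclideanSpace ℝ (Fin 3) → ℝ}
    (hψ : IsSpaceTimeTestOn (⊤ : Opens (ℝ × EuclideanSpace ℝ (Fin 3))) ψ) :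
    ∫ s, ∫ y, (‖U s y + W s y‖ ^ 2 / 2 + frobeniusNormSq (G s y + fderiv ℝ (W s) y)) * ψ s y ≤
      ∫ s, ∫ y, (‖U s y + W s y‖ ^ 2 / 2 * (timeDeriv ψ s y + Δ (ψ s) y) +
        (‖U s y + W s y‖ ^ 2 / 2 * ⟪W s y + V s y - y, gradient (ψ s) y⟫ +
          p s y * ⟪U s y + W s y, gradient (ψ s) y⟫) -
        ⟪fderiv ℝ (W s) y (U s y - V s y), U s y + W s y⟫ * ψ s y) := by
  obtain ⟨iL, iR, h⟩ := local_energy_balance_eq hW hdivW hV1 hVm hVb hdivV hG hU2 hG2 hpq hUq hStokes hψ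
  rw [Measure.volume_eq_prod] at iL iR
  have e1 := integral_prod _ iL
  have e2 := integral_prod _ iR
  dsimp only at e1 e2
  rw [← e1, ← e2, ← Measure.volume_eq_prod]
  exact h.le

end Main

end BradshawTsai2017

end Literature.Analysis.FluidPDE

end
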